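import Summits.BirchSwinnertonDyer.BirchSwinnertonDyer.Theorems.PrintX8VSInputHondaSystemSprungLog
import Summits.BirchSwinnertonDyer.Rank1Residual.Additive.KobayashiLogFssValues
import HarnessLib

/-!
# The values of Sprung's logarithm: `log_{F_ss}(y) = ∑ₖ x_k ((1+y)^{pᵏ} − 1)` at every point `‖y‖ < 1` of a complete
# ultrametric normed `ℚ_p`-algebra (rearrangement), the finite form at `p`-power roots of unity, and the CONGRUENCE form
# `log_{F_ss}(y) ∈ K' + 𝒪_K` (route `PrintX8VS` / `PrintX8`, support item `InputHondaSystem` = stmt-BirchSwinnertonDyer-20413,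
# named fact `Sprung2012.thm22_exists_isHondaSystem`; file 2 of the local series — the general-`a_p` twin of the tree's
# `Rank1Residual/Additive/KobayashiLogFssValues` (`a_p = 0`), whose architecture it follows)

HONEST FRAMING (desk `pub/bsd-wall/bsd-inputs`, seat `bsd-inputs-honda-p1`, D-0154 (2) INPUTS): THEOREMS ONLY — no definition, no
named fact, no instance, no `sorry`; closes nothing by itself; BSD is not proved by any of this.

Setting: the Sprung sequence `x : ℕ → ℚ_p` (data with `x 0 = 1`, `p x 1 = a`, `p x (k+2) = a x (k+1) − x k`, `‖a‖ ≤ p⁻¹`; file 1,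
`SprungHonda.norm_sprungSeq_le`: `‖x k‖ ≤ (√p)ᵏ`), the logarithm `log = PowerSeries.mk fun d ↦ ∑' k, x_k (C(pᵏ,d) − [d=0])`
(file 1), `K` a complete ultrametric normed `ℚ_p`-algebra and field, `‖y‖ < 1`; the `k`-th ROW is `x_k ((1+y)^{pᵏ} − 1)`.

* §1 the double family `(k, d) ↦ x_k(C(pᵏ,d) − [d=0]) yᵈ` is summable (`‖·‖ ≤ d (√p)⁻ᵏ ‖y‖ᵈ`), its rows sum to `x_k((1+y)^{pᵏ} − 1)`
  (binomial theorem) and its columns to `[Xᵈ]log · yᵈ`.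
* §2 **`hasSum_sprungRow`: `∑ₖ x_k((1+y)^{pᵏ} − 1) = qEval log y`** (Sprung's display, p. 1487, read at a point);
  `qEval_sprungLog_eq_sum_of_pow_eq_one`: the FINITE form when `(1+y)^{pᵏ} = 1` for `k ≥ k₀` (the case `y = ζ_{p^{k₀}} − 1`).
* §3 **`exists_mem_norm_qEval_sprungLog_sub_le_one`**: if every `z ∈ 𝒪_K` has `zᵖ ∈ s + p𝒪_K` with `s ∈ K' ∩ 𝒪_K` (`K'` a
  subfield containing `ℚ_p`), then `log(y) ∈ K' + 𝒪_K` (`(1+y)^{pᵏ} ∈ K' ∩ 𝒪 + pᵏ𝒪`, so row `k` is in `K' + x_k pᵏ𝒪 ⊆ K' + 𝒪`; the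
  tail is small) — Kobayashi's Prop. 8.11 mechanism for general `a_p`.

References: [Sprung2012] F. Sprung, J. Number Theory 132 (2012), proof of Thm. 2.2 (p. 1487); [Kobayashi2003] S. Kobayashi,
Invent. Math. 152 (2003), §8.2, Lemma 8.9, Prop. 8.11 (proof).
-/

set_option autoImplicit false
-- the Theorems namespace of this sub repeats the summit name by design (D-0017 nested layout)
set_option linter.dupNamespace false

noncomputable section

open scoped Classical Topology
open Filter PowerSeries Finset

namespace Summit.BirchSwinnertonDyer.BirchSwinnertonDyer.Theorems

namespace SprungHonda

open Summit.BirchSwinnertonDyer.Rank1Residual.Additive.BallEval Summit.BirchSwinnertonDyer.Rank1Residual.Additive.HondaFss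

variable {p : ℕ} [hp : Fact p.Prime] {K : Type*} [NontriviallyNormedField K] [NormedAlgebra ℚ_[p] K]

/-! ## §1 The double family -/

/-- The row as a finite sum of the terms: `x_k((1+y)^{pᵏ} − 1) = ∑_{d ≤ pᵏ} x_k(C(pᵏ,d) − [d=0]) · yᵈ` (binomial theorem).
[folklore] -/
theorem sprungRow_eq_sum (x : ℕ → ℚ_[p]) (y : K) (k : ℕ) :
    algebraMap ℚ_[p] K (x k) * ((1 + y) ^ p ^ k - 1) =
      ∑ d ∈ range (p ^ k + 1), algebraMap ℚ_[p] K (x k * (((p ^ k).choose d : ℚ_[p]) - if d = 0 then 1 else 0)) * y ^ d := by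
  rw [add_comm (1 : K) y, add_pow]
  simp only [one_pow, mul_one]
  have h1 : (∑ d ∈ range (p ^ k + 1), y ^ d * ((p ^ k).choose d : K)) - 1 =
      ∑ d ∈ range (p ^ k + 1), (((p ^ k).choose d : K) - if d = 0 then 1 else 0) * y ^ d := by
    have hone : (1 : K) = ∑ d ∈ range (p ^ k + 1), (if d = 0 then (1 : K) else 0) * y ^ d := by
      rw [Finset.sum_eq_single 0 (fun d _ hd ↦ by rw [if_neg hd, zero_mul]) (fun h ↦ absurd (by simp) h)]
      simp
    conv_lhs => rw [hone, ← Finset.sum_sub_distrib]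
    refine Finset.sum_congr rfl fun d _ ↦ ?_
    split_ifs <;> ring
  rw [h1, Finset.mul_sum]
  refine Finset.sum_congr rfl fun d _ ↦ ?_
  rw [map_mul, map_sub, map_natCast]
  split_ifs with hd
  · rw [map_one]; ring
  · rw [map_zero]; ring

/-- The terms of the row vanish beyond `d = pᵏ`. [folklore] -/
theorem sprungTerm_eq_zero_of_lt (x : ℕ → ℚ_[p]) {k d : ℕ} (h : p ^ k < d) :
    x k * (((p ^ k).choose d : ℚ_[p]) - if d = 0 then 1 else 0) = 0 := by
  rw [Nat.choose_eq_zero_of_lt h, if_neg (by omega)]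
  simp

/-- Row sums: `∑_d x_k(C(pᵏ,d) − [d=0]) yᵈ = x_k((1+y)^{pᵏ} − 1)`. [folklore] -/
theorem hasSum_sprung_row (x : ℕ → ℚ_[p]) (y : K) (k : ℕ) :
    HasSum (fun d : ℕ ↦ algebraMap ℚ_[p] K (x k * (((p ^ k).choose d : ℚ_[p]) - if d = 0 then 1 else 0)) * y ^ d)
      (algebraMap ℚ_[p] K (x k) * ((1 + y) ^ p ^ k - 1)) := by
  rw [sprungRow_eq_sum]
  refine hasSum_sum_of_ne_finset_zero fun d hd ↦ ?_
  rw [mem_range, not_lt] at hd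
  rw [sprungTerm_eq_zero_of_lt x (by omega), map_zero, zero_mul]

/-- Column sums: `∑_k x_k(C(pᵏ,d) − [d=0]) yᵈ = [Xᵈ]log · yᵈ`. [folklore] -/
theorem hasSum_sprung_col {x : ℕ → ℚ_[p]} (hxb : ∀ k, ‖x k‖ ≤ Real.sqrt p ^ k) (y : K) (d : ℕ) :
    HasSum (fun k : ℕ ↦ algebraMap ℚ_[p] K (x k * (((p ^ k).choose d : ℚ_[p]) - if d = 0 then 1 else 0)) * y ^ d)
      (algebraMap ℚ_[p] K (coeff d (PowerSeries.mk fun d ↦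
        ∑' k : ℕ, x k * (((p ^ k).choose d : ℚ_[p]) - if d = 0 then 1 else 0))) * y ^ d) := by
  rw [coeff_sprungLog]
  exact ((summable_sprungTerm hxb d).hasSum.map (algebraMap ℚ_[p] K) (continuous_algebraMap ℚ_[p] K)).mul_right (y ^ d)

/-- **Summability of the double family**: `‖x_k(C(pᵏ,d) − [d=0]) yᵈ‖ ≤ ((√p)⁻¹)ᵏ · (d ‖y‖ᵈ)`. [folklore] -/
theorem summable_sprung_double [CompleteSpace K] {x : ℕ → ℚ_[p]} (hxb : ∀ k, ‖x k‖ ≤ Real.sqrt p ^ k) {y : K}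
    (hy : ‖y‖ < 1) :
    Summable fun kd : ℕ × ℕ ↦
      algebraMap ℚ_[p] K (x kd.1 * (((p ^ kd.1).choose kd.2 : ℚ_[p]) - if kd.2 = 0 then 1 else 0)) * y ^ kd.2 := by
  obtain ⟨hr1, hr0⟩ := sqrt_inv_lt_one (p := p)
  have hg1 : Summable fun k : ℕ ↦ ((Real.sqrt p)⁻¹ : ℝ) ^ k := summable_geometric_of_lt_one hr0 hr1
  have hg2 : Summable fun d : ℕ ↦ (d : ℝ) * ‖y‖ ^ d := by
    simpa [pow_one] using summable_pow_mul_geometric_of_norm_lt_one 1 (r := ‖y‖) (by rwa [norm_norm])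
  refine Summable.of_norm_bounded (hg1.mul_of_nonneg hg2 (fun k ↦ by positivity) (fun d ↦ by positivity)) ?_
  rintro ⟨k, d⟩
  dsimp only
  rw [norm_mul, norm_pow, norm_algebraMap_padic]
  calc ‖x k * (((p ^ k).choose d : ℚ_[p]) - if d = 0 then 1 else 0)‖ * ‖y‖ ^ d
      ≤ (d * ((Real.sqrt p)⁻¹) ^ k) * ‖y‖ ^ d := mul_le_mul_of_nonneg_right (norm_sprungTerm_le hxb k d) (by positivity)
    _ = ((Real.sqrt p)⁻¹) ^ k * (d * ‖y‖ ^ d) := by ring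

/-! ## §2 `log_{F_ss}(y) = ∑ₖ x_k((1+y)^{pᵏ} − 1)` -/

/-- **`∑ₖ x_k((1+y)^{pᵏ} − 1) = log_{F_ss}(y)`** (`= qEval log y`) for `‖y‖ < 1` in a complete ultrametric normed
`ℚ_p`-algebra: both are iterated sums of the summable double family. [cite: Sprung2012, proof of Thm. 2.2 (p. 1487)] -/
theorem hasSum_sprungRow [CompleteSpace K] {x : ℕ → ℚ_[p]} (hxb : ∀ k, ‖x k‖ ≤ Real.sqrt p ^ k) {y : K} (hy : ‖y‖ < 1) :
    HasSum (fun k : ℕ ↦ algebraMap ℚ_[p] K (x k) * ((1 + y) ^ p ^ k - 1))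
      (qEval p K (PowerSeries.mk fun d ↦ ∑' k : ℕ, x k * (((p ^ k).choose d : ℚ_[p]) - if d = 0 then 1 else 0)) y) := by
  have hs := summable_sprung_double hxb hy
  have h1 : HasSum (fun k : ℕ ↦ algebraMap ℚ_[p] K (x k) * ((1 + y) ^ p ^ k - 1))
      (∑' kd : ℕ × ℕ, algebraMap ℚ_[p] K (x kd.1 * (((p ^ kd.1).choose kd.2 : ℚ_[p]) - if kd.2 = 0 then 1 else 0)) *
        y ^ kd.2) :=
    hs.hasSum.prod_fiberwise fun k ↦ hasSum_sprung_row x y k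
  have hs' := (Equiv.prodComm ℕ ℕ).summable_iff.mpr hs
  have h2 : HasSum (fun d : ℕ ↦ algebraMap ℚ_[p] K (coeff d (PowerSeries.mk fun d ↦
        ∑' k : ℕ, x k * (((p ^ k).choose d : ℚ_[p]) - if d = 0 then 1 else 0))) * y ^ d)
      (∑' dk : ℕ × ℕ, algebraMap ℚ_[p] K (x dk.2 * (((p ^ dk.2).choose dk.1 : ℚ_[p]) - if dk.1 = 0 then 1 else 0)) *
        y ^ dk.1) :=
    hs'.hasSum.prod_fiberwise fun d ↦ hasSum_sprung_col hxb y d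
  have h3 := hasSum_qEval (K := K) (norm_coeff_sprungLog_le hxb) hy
  rw [h3.unique h2, ← (Equiv.prodComm ℕ ℕ).tsum_eq]
  exact h1

/-- `log_{F_ss}(y) = ∑' k, x_k((1+y)^{pᵏ} − 1)`. [folklore] -/
theorem qEval_sprungLog_eq_tsum [CompleteSpace K] {x : ℕ → ℚ_[p]} (hxb : ∀ k, ‖x k‖ ≤ Real.sqrt p ^ k) {y : K}
    (hy : ‖y‖ < 1) :
    qEval p K (PowerSeries.mk fun d ↦ ∑' k : ℕ, x k * (((p ^ k).choose d : ℚ_[p]) - if d = 0 then 1 else 0)) y =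
      ∑' k : ℕ, algebraMap ℚ_[p] K (x k) * ((1 + y) ^ p ^ k - 1) :=
  (hasSum_sprungRow hxb hy).tsum_eq.symm

/-- **Finite form**: if `(1+y)^{pᵏ} = 1` for all `k ≥ k₀` then `log_{F_ss}(y) = ∑_{k < k₀} x_k((1+y)^{pᵏ} − 1)` (the case
`y = ζ_{p^{k₀}} − 1` of [K] Lemma 8.9 / Sprung Thm. 2.2). [cite: Kobayashi2003, Lemma 8.9] -/
theorem qEval_sprungLog_eq_sum_of_pow_eq_one [CompleteSpace K] {x : ℕ → ℚ_[p]} (hxb : ∀ k, ‖x k‖ ≤ Real.sqrt p ^ k)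
    {y : K} (hy : ‖y‖ < 1) {k₀ : ℕ} (h : ∀ k, k₀ ≤ k → (1 + y) ^ p ^ k = 1) :
    qEval p K (PowerSeries.mk fun d ↦ ∑' k : ℕ, x k * (((p ^ k).choose d : ℚ_[p]) - if d = 0 then 1 else 0)) y =
      ∑ k ∈ range k₀, algebraMap ℚ_[p] K (x k) * ((1 + y) ^ p ^ k - 1) := by
  refine (hasSum_sprungRow hxb hy).unique (hasSum_sum_of_ne_finset_zero fun k hk ↦ ?_)
  rw [mem_range, not_lt] at hk
  rw [h k hk, sub_self, mul_zero]

/-! ## §3 The congruence form `log_{F_ss}(y) ∈ K' + 𝒪_K` -/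

/-- **`log_{F_ss}(y) ∈ K' + 𝒪_K`**: for a subfield `K' ⊇ ℚ_p` such that every `z ∈ 𝒪_K` has `zᵖ ∈ (K' ∩ 𝒪_K) + p𝒪_K`, and
every `‖y‖ < 1`, there is `μ ∈ K'` with `‖log_{F_ss}(y) − μ‖ ≤ 1`. (Rows: `(1+y)^{pᵏ} = s_k + e_k`, `‖e_k‖ ≤ ‖p‖ᵏ`, so row
`k` is `x_k(s_k − 1) + x_k e_k` with `x_k(s_k − 1) ∈ K'` and `‖x_k e_k‖ ≤ (√p)ᵏ p⁻ᵏ ≤ 1`; the tail of the convergent series is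
eventually of norm `≤ 1`.) [cite: Kobayashi2003, Prop. 8.11 (proof)] -/
theorem exists_mem_norm_qEval_sprungLog_sub_le_one [IsUltrametricDist K] [CompleteSpace K] {x : ℕ → ℚ_[p]}
    (hxb : ∀ k, ‖x k‖ ≤ Real.sqrt p ^ k) (K' : Subfield K) (hK' : ∀ q : ℚ_[p], algebraMap ℚ_[p] K q ∈ K')
    (hFrob : ∀ z : K, ‖z‖ ≤ 1 → ∃ s ∈ K', ‖s‖ ≤ 1 ∧ ‖z ^ p - s‖ ≤ ‖(p : K)‖)
    {y : K} (hy : ‖y‖ < 1) :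
    ∃ μ ∈ K', ‖qEval p K (PowerSeries.mk fun d ↦
      ∑' k : ℕ, x k * (((p ^ k).choose d : ℚ_[p]) - if d = 0 then 1 else 0)) y - μ‖ ≤ 1 := by
  obtain ⟨hr1, hr0⟩ := sqrt_inv_lt_one (p := p)
  obtain ⟨hq0, hq1⟩ : 0 < ‖(p : K)‖ ∧ ‖(p : K)‖ < 1 := by
    rw [norm_natCast_p]
    exact ⟨inv_pos.mpr (by exact_mod_cast hp.out.pos), inv_lt_one_of_one_lt₀ (by exact_mod_cast hp.out.one_lt)⟩
  have hsum := hasSum_sprungRow hxb hy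
  -- tail: rows tend to `0`, so eventually `‖row k‖ ≤ 1`
  have htend := hsum.summable.tendsto_atTop_zero
  rw [Metric.tendsto_atTop] at htend
  obtain ⟨N, hN⟩ := htend 1 one_pos
  have hN' : ∀ k, N ≤ k → ‖algebraMap ℚ_[p] K (x k) * ((1 + y) ^ p ^ k - 1)‖ ≤ 1 := fun k hk ↦ by
    have := hN k hk; rw [dist_zero_right] at this; exact this.le
  -- each row `k` is in `K' + 𝒪`
  have hrow : ∀ k, ∃ μ ∈ K', ‖algebraMap ℚ_[p] K (x k) * ((1 + y) ^ p ^ k - 1) - μ‖ ≤ 1 := by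
    intro k
    rcases Nat.eq_zero_or_pos k with rfl | hk
    · refine ⟨0, K'.zero_mem, ?_⟩
      rw [sub_zero, pow_zero, pow_one, add_sub_cancel_left, norm_mul, norm_algebraMap_padic]
      calc ‖x 0‖ * ‖y‖ ≤ Real.sqrt p ^ 0 * 1 := mul_le_mul (hxb 0) hy.le (norm_nonneg _) (by positivity)
        _ = 1 := by rw [pow_zero, one_mul]
    · have hz : ‖1 + y‖ ≤ 1 := (IsUltrametricDist.norm_add_le_max _ _).trans (max_le (by rw [norm_one]) hy.le)
      obtain ⟨s, hs, hs1, hse⟩ := exists_norm_pow_sub_le K' hFrob hz hk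
      refine ⟨algebraMap ℚ_[p] K (x k) * (s - 1), K'.mul_mem (hK' _) (K'.sub_mem hs K'.one_mem), ?_⟩
      have e : algebraMap ℚ_[p] K (x k) * ((1 + y) ^ p ^ k - 1) - algebraMap ℚ_[p] K (x k) * (s - 1) =
          algebraMap ℚ_[p] K (x k) * ((1 + y) ^ p ^ k - s) := by ring
      rw [e, norm_mul, norm_algebraMap_padic]
      calc ‖x k‖ * ‖(1 + y) ^ p ^ k - s‖ ≤ Real.sqrt p ^ k * ‖(p : K)‖ ^ k :=
            mul_le_mul (hxb k) hse (norm_nonneg _) (by positivity)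
        _ = ((Real.sqrt p)⁻¹) ^ k := by rw [norm_natCast_p, sqrt_pow_mul_inv_pow]
        _ ≤ 1 := pow_le_one₀ hr0 hr1.le
  -- assemble: finite part + tail
  choose μ hμK hμ using hrow
  refine ⟨∑ k ∈ range N, μ k, K'.sum_mem fun k _ ↦ hμK k, ?_⟩
  have hsplit : qEval p K (PowerSeries.mk fun d ↦
        ∑' k : ℕ, x k * (((p ^ k).choose d : ℚ_[p]) - if d = 0 then 1 else 0)) y =
      (∑ k ∈ range N, algebraMap ℚ_[p] K (x k) * ((1 + y) ^ p ^ k - 1)) +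
        ∑' k : ℕ, algebraMap ℚ_[p] K (x (k + N)) * ((1 + y) ^ p ^ (k + N) - 1) := by
    rw [← hsum.tsum_eq, ← hsum.summable.sum_add_tsum_nat_add N]
  rw [hsplit, add_sub_right_comm, ← Finset.sum_sub_distrib]
  refine (IsUltrametricDist.norm_add_le_max _ _).trans (max_le ?_ ?_)
  · exact IsUltrametricDist.norm_sum_le_of_forall_le_of_nonneg zero_le_one fun k _ ↦ hμ k
  · exact IsUltrametricDist.norm_tsum_le_of_forall_le_of_nonneg zero_le_one fun k ↦ hN' _ (by omega)

end SprungHonda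

end Summit.BirchSwinnertonDyer.BirchSwinnertonDyer.Theorems

end
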